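import Literature.ComputerArithmetic.RumpOgitaOishi2008.AccSum
import Literature.ComputerArithmetic.BoldoJeannerodMelquiondMuller2023.RoundToNearestEven

/-!
# Rump–Ogita–Oishi 2008: Algorithm 3.6 `NextPowerTwo` with Theorem 3.7, and Theorem 4.8 (the number
# of passes of `Transform` / `AccSum` in terms of the condition number)

HONEST FRAMING (ENGINES group, unit `eng-quad-4`, kernels lane of the `certquad` engine — shared
numerical engines serving client cells; rigour lives in the verifiers; every published number
belongs to a client cell's ledger, not to the engines group): two items of Part I of the accurate-summation
papers left untyped by `ExtractVector` / `AccSum`, typed and PROVED at FORMAT LEVEL — over the tree's binary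
floating-point numbers `JeannerodRump2018.IsFloat p emin` (precision `p`, gradual underflow from `emin`, NO
overflow) and round-to-nearest maps `JeannerodRump2018.IsRoundNearest p emin fl`; IEEE 754 rounding to
nearest TIES TO EVEN is the tree's `BoldoJeannerodMelquiondMuller2023.roundTiesEven p emin`:
* ALGORITHM 3.6 `NextPowerTwo` and THEOREM 3.7 (`L = 2^⌈log₂|p|⌉`, ties to even, precision `p ≥ 2`), with
  the tie-rule analysis for ARBITRARY roundings to nearest (the source's Remark "rounding tie to even … is
  mandatory" as a theorem: another rounding to nearest yields `L = 2^(⌈log₂|p|⌉+1)` on powers of two);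
* eq. (4.25) (the condition number of a sum) and THEOREM 4.8 (if `cond(Σ pᵢ) ≤ (1 − 2⁻ᴹ)2^(−2M−1)[2⁻ᴹeps⁻¹]ᵐ`
  then `Transform` stops after at most `m` executions of its "repeat–until"-loop), for ANY rounding to nearest.
No hardware, vendor, timing, flop-count or IEEE-format claims: `p` and `emin` are parameters.

Source read at the page: [RumpOgitaOishi2008] S. M. Rump, T. Ogita, S. Oishi, *Accurate floating-point
summation part I: faithful rounding*, SIAM J. Sci. Comput. 31(1) (2008) 189–224, doi:10.1137/050645671;
read in the authors' version (33 pp.; its page numbers are used): p. 4 (`F`, `eps`, `eta`, `ufp`), p. 7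
(Lemma 2.2), p. 9 (Lemma 2.6), p. 14 (Algorithm 3.6 `NextPowerTwo`, Theorem 3.7 with the Remark — "rounding
tie to even as in the IEEE 754 arithmetic standard is mandatory" — and the proof), p. 15 (Algorithm 4.1,
Remark 2: "for clarity … the logarithm in the computation of `M` and `σ₀` … will be replaced by Algorithm 3.6"),
p. 22 (Remark 2 after Corollary 4.7, the condition number (4.25), Theorem 4.8 with (4.26)), p. 23 (Table 4.2,
the conclusion of Theorem 4.8 and its proof, eqs. (4.27)–(4.29)). The tie rule: [BoldoEtAl2023] S. Boldo,
C.-P. Jeannerod, G. Melquiond, J.-M. Muller, *Floating-point arithmetic*, Acta Numerica 32 (2023), §2.2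
(`RN_e`, typed in `RoundToNearestEven`).

DICTIONARY (source ↦ here; carriers `ℚ`; the dictionaries of `ExtractVector` and `AccSum` — `F ↦ IsFloat p
emin`, `fl ↦ IsRoundNearest p emin fl`, `eps ↦ unitRoundoff p = 2^-p`, `eta ↦ 2^emin`, `½eps⁻¹eta ↦
2^(emin+p-1)`, `ufp`, `gℤ ↦ OnGrid g`, `μ ↦ maxAbs`, `M = ⌈log₂(n + 2)⌉ ↦ Nat.clog 2 (n + 2)`, `⌈log₂ μ⌉ ↦
Int.clog 2 μ`, `σ₀ = 2^(M + ⌈log₂ μ⌉)`, the loop of Algorithm 4.1 ↦ `transformAux`, `Transform ↦ transform` —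
continue).
* Algorithm 3.6: the input `p` of the source ↦ `x` (`p` is the precision here); `eps⁻¹ ↦ 2^p` (`inv_u`);
  `q = eps⁻¹p ↦ fl (2^p * x)` (`= 2^p·x` exactly, `fl_two_pow_mul`: no overflow in this model);
  `L = fl(|(q + p) − q|)` ↦ `nextPowerTwoL fl p x = |fl (fl (q + x) − q)|` (the absolute value of a float is
  exact); the result `L` ↦ `nextPowerTwo fl p x` (`= |x|` if `nextPowerTwoL = 0`, else `nextPowerTwoL`);
  `2^⌈log₂|p|⌉ ↦ (2 : ℚ) ^ Int.clog 2 |x|`; "`p` is a power of 2" ↦ `|x| = ufp x` (equivalently `|x| = 2^k`),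
  "not a power of 2" ↦ `ufp x < |x|`; "rounding tie to even" ↦ `fl = roundTiesEven p emin`.
* Theorem 4.8: `cond(Σ pᵢ) = Σ|pᵢ| / |Σ pᵢ|` (4.25) ↦ `condSum xs`; "the number `m` of executions of the
  repeat-until-loop" ↦ `transformPasses fl p emin xs` (`transformCount` along the recursion of `transformAux`;
  `transform_eq_transformAux_passes`: the results of `transform` are those of exactly that many passes);
  `ϕ = 2ᴹeps ↦ 2^M * unitRoundoff p`; `[2⁻ᴹeps⁻¹]ᵐ ↦ (2^p / 2^M)^m`; `2²ᴹeps ≤ 1 ↦ 2 * M ≤ p`.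

Typed and PROVED here:
* ALGORITHM 3.6 — `nextPowerTwoL`, `nextPowerTwo` (definitions), `isFloat_two_pow_mul`, `fl_two_pow_mul`
  (`q = eps⁻¹p` is exact), `nextPowerTwoL_neg` / `nextPowerTwo_neg` (the "without loss of generality `p > 0`"
  symmetry: `NextPowerTwo(−p)` under `fl` is `NextPowerTwo(p)` under the mirrored rounding `t ↦ −fl(−t)`).
* THEOREM 3.7, the proof's two cases for EVERY rounding to nearest — `fl_two_pow_mul_add_sub_eq` (not a power
  of 2: `fl(q + p) = succ(q)`, `fl(q + p) − q = 2ufp(p)`), `fl_two_pow_mul_add_eq_or` (`|p| = 2^k`: `fl(q + p) ∈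
  {q, q + 2p}`), `nextPowerTwoL_eq_of_lt`, `nextPowerTwoL_two_zpow`, `nextPowerTwo_eq_of_ufp_lt` (**not a power
  of 2 ⟹ `L = 2ufp(p) = 2^⌈log₂|p|⌉`, any tie rule**), `nextPowerTwo_two_zpow` / `nextPowerTwo_of_abs_eq_two_zpow`
  (`|p| = 2^k` ⟹ `L ∈ {2^k, 2^(k+1)}`, and `L = 2^k` iff `fl(q + p) = q`), `nextPowerTwo_eq_or` (summary).
* THEOREM 3.7 proper — `ulp_two_pow_mul_add_self`, `floor_div_eq_and_tie`, `roundTiesEven_two_pow_mul_add`,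
  `roundTiesEven_two_pow_mul_neg_add` (ties to even at `±q(1 + eps)` give `q`), **`nextPowerTwo_roundTiesEven`**
  (`p ∈ F \ {0}`, precision `≥ 2` ⟹ `NextPowerTwo(p) = 2^⌈log₂|p|⌉` under `RN_e`, underflow range included);
  the Remark as theorems: `exists_isRoundNearest_nextPowerTwo_ne` (for every `2^k ∈ F` some rounding to
  nearest gives `L = 2^(k+1) ≠ 2^⌈log₂ 2^k⌉`), `nextPowerTwo_roundTiesEven_prec_one` (precision 1: `RN_e` itself
  gives `L = 2^(k+1)`, so `p ≥ 2` is needed).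
* Eq. (4.25) — `condSum`; THEOREM 4.8 — `transformCount`, `transformPasses` (the pass count),
  `transformCount_le_fuel`, `transformAux_count_eq`, `one_le_transformPasses`, `transform_eq_transformAux_passes`,
  `maxAbs_le_sum_abs`, `transformCount_le_of_le_abs` (the loop estimate (4.27)–(4.29): `|s| ≥ (2ᴹ + 1)ϕᵐσ` ⟹ at
  most `m` more passes), `transformPasses_le_of_le_abs`, **`transformPasses_le_of_cond_le`** (Theorem 4.8 as
  printed, hypothesis (4.26)).

NOTES. (a) TIE RULE AND PRECISION. Theorem 3.7 is proved for the tree's `roundTiesEven` with `p ≥ 2`; its two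
halves hold more generally — for `p` not a power of two under ANY rounding to nearest (`p ≥ 1`), and for
`|p| = 2^k` exactly when the tie `q(1 + eps)` is rounded to `q` (so ties-to-even, or ties-toward-zero; NOT
ties-away, and not `RN_e` in precision 1). Theorem 4.8, like Lemma 4.2 and Proposition 4.6 in `AccSum`, holds
for every rounding to nearest. (b) OVERFLOW. The source's proviso "if no overflow occurs" is vacuous in this
model (no overflow); underflow IS covered (`p ∈ U` allowed), as the source stresses. (c) THE BRANCH `L = 0`.
It is taken iff `|p|` is a power of two and `fl(q + p) = q` (`nextPowerTwoL_two_zpow`, `nextPowerTwoL_eq_of_lt`).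
(d) THEOREM 4.8 is typed for `Transform` = Algorithm 4.1 as called by `AccSum` (`transform`), exactly as its
proof does ("for the analysis we use the (except the check for zero) identical Algorithm 4.1"); the count is
typed by the same structural recursion as the loop and shown to be the number of passes actually performed
(`transform_eq_transformAux_passes`). For `m = 0` the hypothesis (4.26) is unsatisfiable (`cond ≥ 1`), in
accordance with `one_le_transformPasses`. (e) NOT typed here: the flop count `(4m + 3)n + O(m)` of Theorem 4.8,
Table 4.2, the `lim sup` definition of the condition number of [19] (only its value (4.25)), Algorithm 4.4 (the
final `Transform` with the check for zero and with `M`, `σ₀` computed by `NextPowerTwo`), §§5–6, Part II.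
-/

namespace Literature.ComputerArithmetic.RumpOgitaOishi2008

open Literature.ComputerArithmetic.JeannerodRump2018
open Literature.ComputerArithmetic.BoldoJeannerodMelquiondMuller2023
-- landed engine lemmas reused by name (`2^k ∈ F`, `|f| ≥ eta` for `f ∈ F \ {0}`, `|Σ| ≤ Σ|·|`):
open Literature.ComputerArithmetic.JoldesMullerPopescu2017 (isFloat_two_zpow two_zpow_emin_le_abs)
open Literature.ComputerArithmetic.LangeRump2018 (abs_list_sum_le)

variable {p : ℕ} {emin : ℤ} {fl : ℚ → ℚ}

/-! ### Algorithm 3.6 (`NextPowerTwo`): the definitions -/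

/-- The quantity `L = fl(|(q + p) − q|)` of Algorithm 3.6 before the final test, with `q = fl(eps⁻¹p)`
(`eps⁻¹ = 2^p`; the input `p` of the source is our `x`, `p` being the precision; the absolute value of a
float is exact). [cite: RumpOgitaOishi2008, Algorithm 3.6] -/
def nextPowerTwoL (fl : ℚ → ℚ) (p : ℕ) (x : ℚ) : ℚ :=
  |fl (fl (fl (2 ^ p * x) + x) - fl (2 ^ p * x))|

/-- **ALGORITHM 3.6** `L = NextPowerTwo(p)` ("computation of `2^⌈log₂|p|⌉` for `p ≠ 0`"): `q = eps⁻¹p`,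
`L = fl(|(q + p) − q|)`, `if L = 0, L = |p|, end if`. [cite: RumpOgitaOishi2008, Algorithm 3.6] -/
def nextPowerTwo (fl : ℚ → ℚ) (p : ℕ) (x : ℚ) : ℚ :=
  if nextPowerTwoL fl p x = 0 then |x| else nextPowerTwoL fl p x

/-- `eps⁻¹ = 2^p`. [cite: RumpOgitaOishi2008, Algorithm 3.6 (`q = eps⁻¹p`)] -/
theorem inv_u : (unitRoundoff p)⁻¹ = (2 : ℚ) ^ p := by
  rw [unitRoundoff, one_div, inv_inv]

/-- `eps⁻¹p = 2^p·p ∈ F` for `p ∈ F` (no overflow in this model), so `q = fl(eps⁻¹p) = eps⁻¹p`.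
[cite: RumpOgitaOishi2008, Algorithm 3.6 (`q = eps⁻¹p`)] -/
theorem isFloat_two_pow_mul {x : ℚ} (hx : IsFloat p emin x) : IsFloat p emin (2 ^ p * x) := by
  obtain ⟨M, e, hM, he, rfl⟩ := hx
  refine ⟨M, e + p, hM, by omega, ?_⟩
  rw [zpow_add₀ (by norm_num : (2 : ℚ) ≠ 0), zpow_natCast]; ring

/-- `q = fl(eps⁻¹p) = eps⁻¹p` exactly. [cite: RumpOgitaOishi2008, Algorithm 3.6 (`q = eps⁻¹p`)] -/
theorem fl_two_pow_mul (hfl : IsRoundNearest p emin fl) {x : ℚ} (hx : IsFloat p emin x) :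
    fl (2 ^ p * x) = 2 ^ p * x :=
  fl_eq_self hfl (isFloat_two_pow_mul hx)

/-- Symmetry ("without loss of generality we assume `p > 0`"): `NextPowerTwo` at `−p` under `fl` is
`NextPowerTwo` at `p` under the mirrored rounding `t ↦ −fl(−t)` (again a rounding to nearest,
`IsRoundNearest.neg`) — the quantity `L`.
[cite: RumpOgitaOishi2008, Theorem 3.7 (proof, "without loss of generality")] -/
theorem nextPowerTwoL_neg (fl : ℚ → ℚ) (p : ℕ) (x : ℚ) :
    nextPowerTwoL fl p (-x) = nextPowerTwoL (fun t => -fl (-t)) p x := by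
  show |fl (fl (fl (2 ^ p * -x) + -x) - fl (2 ^ p * -x))| =
    |-fl (-(-fl (-(-fl (-(2 ^ p * x)) + x)) - -fl (-(2 ^ p * x))))|
  rw [abs_neg, mul_neg]
  congr 2
  rw [show -(-fl (-(2 ^ p * x)) + x) = fl (-(2 ^ p * x)) + -x by ring]
  ring

/-- Symmetry for the result: `NextPowerTwo_fl(−p) = NextPowerTwo_{t ↦ −fl(−t)}(p)`.
[cite: RumpOgitaOishi2008, Theorem 3.7 (proof, "without loss of generality")] -/
theorem nextPowerTwo_neg (fl : ℚ → ℚ) (p : ℕ) (x : ℚ) :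
    nextPowerTwo fl p (-x) = nextPowerTwo (fun t => -fl (-t)) p x := by
  simp only [nextPowerTwo, nextPowerTwoL_neg, abs_neg]

/-! ### Theorem 3.7: the analysis of `fl(q + p)` for `q = eps⁻¹p` -/

/-- The case "`p` not a power of 2", `p > 0`, `ufp(p) = 2^E < p < 2^(E+1)`: `q = eps⁻¹p ∉ U`,
`succ(q) = q + 2eps·ufp(q) = q + 2ufp(p)` and `q + eps·ufp(q) < q + p < succ(q)`, so rounding to nearest
(ANY tie rule) gives `fl(q + p) = succ(q)`, i.e. `fl(q + p) − q = 2ufp(p) = 2^(E+1)`.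
[cite: RumpOgitaOishi2008, Theorem 3.7 (proof)] -/
theorem fl_two_pow_mul_add_sub_eq (hp : 1 ≤ p) (hfl : IsRoundNearest p emin fl) {x : ℚ}
    (hx : IsFloat p emin x) {E : ℤ} (hEx : (2 : ℚ) ^ E < x) (hxE : x < (2 : ℚ) ^ (E + 1)) :
    fl (2 ^ p * x + x) - 2 ^ p * x = (2 : ℚ) ^ (E + 1) := by
  have h2 : (2 : ℚ) ≠ 0 := by norm_num
  have hx0 : 0 < x := (two_zpow_pos E).trans hEx
  have hxabs : |x| = x := abs_of_pos hx0
  -- `E ≥ emin` (`x ≥ eta` being a nonzero float)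
  have hE : emin ≤ E := by
    have h1 : (2 : ℚ) ^ emin < (2 : ℚ) ^ (E + 1) :=
      (hxabs ▸ two_zpow_emin_le_abs hx hx0.ne').trans_lt hxE
    have := (zpow_lt_zpow_iff_right₀ (by norm_num : (1 : ℚ) < 2)).mp h1
    omega
  have h2E := two_zpow_pos E
  have hpE : (2 : ℚ) ^ p * (2 : ℚ) ^ (E + 1) = (2 : ℚ) ^ ((p : ℤ) + (E + 1)) := by
    rw [← zpow_natCast, ← zpow_add₀ h2]
  -- `q = 2^p·x ∈ 2^(E+1)ℤ` (`x ∈ 2eps·ufp(x)ℤ = 2^(E−p+1)ℤ`)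
  obtain ⟨m, hm⟩ := onGrid_of_isFloat_of_le_abs hx (E := E) (by rw [hxabs]; exact hEx.le)
  have hq : (2 : ℚ) ^ p * x = (m : ℚ) * (2 : ℚ) ^ (E + 1) := by
    rw [hm, mul_left_comm, ← zpow_natCast, ← zpow_add₀ h2]; congr 2; ring
  -- `m < 2^p`, so `g := q + 2^(E+1) = (m + 1)·2^(E+1) ∈ F`
  have hm_lt : (m : ℚ) < (2 : ℚ) ^ p := by
    have h1 : (2 : ℚ) ^ p * x < (2 : ℚ) ^ p * (2 : ℚ) ^ (E + 1) := mul_lt_mul_of_pos_left hxE (by positivity)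
    rw [hq] at h1
    exact lt_of_mul_lt_mul_right h1 (two_zpow_pos _).le
  have hqgrid : OnGrid ((2 : ℚ) ^ (E + 1)) ((2 : ℚ) ^ p * x) := ⟨m, hq⟩
  have hqpos : 0 < (2 : ℚ) ^ p * x := by positivity
  have hgF : IsFloat p emin ((2 : ℚ) ^ p * x + (2 : ℚ) ^ (E + 1)) := by
    refine isFloat_of_onGrid_two_zpow hp (hqgrid.add (onGrid_self _)) ?_ (by omega)
    have hm1 : ((m : ℚ) + 1) ≤ (2 : ℚ) ^ p := by
      have : m + 1 ≤ (2 : ℤ) ^ p := by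
        exact_mod_cast (show (m : ℚ) < ((2 : ℤ) ^ p : ℤ) by push_cast; exact hm_lt)
      exact_mod_cast this
    rw [abs_of_pos (add_pos hqpos (two_zpow_pos _)), hq, ← add_one_mul]
    exact mul_le_mul_of_nonneg_right hm1 (two_zpow_pos _).le
  -- rounding to nearest: `|fl(q + x) − (q + x)| ≤ |g − (q + x)| = 2^(E+1) − x < 2^E`
  set f : ℚ := fl ((2 : ℚ) ^ p * x + x) with hf
  have hnear : |(2 : ℚ) ^ p * x + x - f| ≤ (2 : ℚ) ^ (E + 1) - x := by
    have := (hfl ((2 : ℚ) ^ p * x + x)).2 _ hgF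
    rwa [show (2 : ℚ) ^ p * x + x - ((2 : ℚ) ^ p * x + (2 : ℚ) ^ (E + 1)) = -((2 : ℚ) ^ (E + 1) - x) by ring,
      abs_neg, abs_of_pos (show (0 : ℚ) < (2 : ℚ) ^ (E + 1) - x by linarith)] at this
  have hE1 : (2 : ℚ) ^ (E + 1) = 2 * (2 : ℚ) ^ E := by rw [zpow_add_one₀ h2, mul_comm]
  obtain ⟨hlo, hhi⟩ := abs_le.mp hnear
  -- so `q < fl(q + x) ≤ q + 2^(E+1)`; `fl(q + x) ∈ F`, `|fl(q + x)| ≥ q ≥ 2^(p+E)` ⟹ `fl(q + x) ∈ 2^(E+1)ℤ`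
  have hfq : (2 : ℚ) ^ p * x < f := by linarith
  have hfle : f ≤ (2 : ℚ) ^ p * x + (2 : ℚ) ^ (E + 1) := by linarith
  have hfgrid : OnGrid ((2 : ℚ) ^ (E + 1)) f := by
    have hle : (2 : ℚ) ^ ((p : ℤ) + E) ≤ |f| := by
      rw [abs_of_pos (hqpos.trans hfq), zpow_add₀ h2, zpow_natCast]
      exact (mul_le_mul_of_nonneg_left hEx.le (by positivity)).trans hfq.le
    have := onGrid_of_isFloat_of_le_abs (hfl _).1 hle
    rwa [show (p : ℤ) + E - p + 1 = E + 1 by ring] at this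
  -- `d := fl(q + x) − q ∈ 2^(E+1)ℤ ∩ (0, 2^(E+1)]`, so `d = 2^(E+1)`
  obtain ⟨j, hj⟩ := hfgrid.sub hqgrid
  have hj0 : (0 : ℚ) < j := by
    have : 0 * (2 : ℚ) ^ (E + 1) < (j : ℚ) * (2 : ℚ) ^ (E + 1) := by rw [← hj, zero_mul]; linarith
    exact lt_of_mul_lt_mul_right this (two_zpow_pos _).le
  have hj1 : (j : ℚ) ≤ 1 := by
    have : (j : ℚ) * (2 : ℚ) ^ (E + 1) ≤ 1 * (2 : ℚ) ^ (E + 1) := by rw [← hj, one_mul]; linarith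
    exact le_of_mul_le_mul_right this (two_zpow_pos _)
  have hj_eq : j = 1 := by
    have h0 : (0 : ℤ) < j := by exact_mod_cast hj0
    have h1 : j ≤ 1 := by exact_mod_cast hj1
    omega
  rw [hj, hj_eq, Int.cast_one, one_mul]

/-- The case `|p| = 2^k`: `q + p = q(1 + eps)` is the midpoint of `q` and `succ(q) = q + 2eps·q`, so a
rounding to nearest returns one of the two: `fl(q + p) = q` (ties-to-even) or `fl(q + p) = q + 2p`.
[cite: RumpOgitaOishi2008, Theorem 3.7 (proof, first case)] -/
theorem fl_two_pow_mul_add_eq_or (hp : 1 ≤ p) (hfl : IsRoundNearest p emin fl) {k : ℤ} (hk : emin ≤ k) :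
    fl (2 ^ p * (2 : ℚ) ^ k + (2 : ℚ) ^ k) = 2 ^ p * (2 : ℚ) ^ k ∨
      fl (2 ^ p * (2 : ℚ) ^ k + (2 : ℚ) ^ k) = 2 ^ p * (2 : ℚ) ^ k + (2 : ℚ) ^ (k + 1) := by
  have h2 : (2 : ℚ) ≠ 0 := by norm_num
  have h2k := two_zpow_pos k
  have hpk : (2 : ℚ) ^ p * (2 : ℚ) ^ k = (2 : ℚ) ^ ((p : ℤ) + k) := by rw [← zpow_natCast, ← zpow_add₀ h2]
  have hk1 : (2 : ℚ) ^ (k + 1) = 2 * (2 : ℚ) ^ k := by rw [zpow_add_one₀ h2, mul_comm]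
  -- `q ∈ F`, so `|fl(q + x) − (q + x)| ≤ x`
  have hqF : IsFloat p emin ((2 : ℚ) ^ p * (2 : ℚ) ^ k) := isFloat_two_pow_mul (isFloat_two_zpow hp hk)
  have hnear := (hfl ((2 : ℚ) ^ p * (2 : ℚ) ^ k + (2 : ℚ) ^ k)).2 _ hqF
  rw [show (2 : ℚ) ^ p * (2 : ℚ) ^ k + (2 : ℚ) ^ k - (2 : ℚ) ^ p * (2 : ℚ) ^ k = (2 : ℚ) ^ k by ring,
    abs_of_pos h2k] at hnear
  obtain ⟨hlo, hhi⟩ := abs_le.mp hnear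
  set f : ℚ := fl ((2 : ℚ) ^ p * (2 : ℚ) ^ k + (2 : ℚ) ^ k) with hf
  have hqf : (2 : ℚ) ^ p * (2 : ℚ) ^ k ≤ f := by linarith
  have hfle : f ≤ (2 : ℚ) ^ p * (2 : ℚ) ^ k + (2 : ℚ) ^ (k + 1) := by rw [hk1]; linarith
  have hqpos : 0 < (2 : ℚ) ^ p * (2 : ℚ) ^ k := by positivity
  -- `f ∈ F`, `|f| ≥ q = 2^(p+k)` ⟹ `f ∈ 2^(k+1)ℤ`; `q = 2^(p-1)·2^(k+1) ∈ 2^(k+1)ℤ`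
  have hfgrid : OnGrid ((2 : ℚ) ^ (k + 1)) f := by
    have hle : (2 : ℚ) ^ ((p : ℤ) + k) ≤ |f| := by rw [abs_of_pos (hqpos.trans_le hqf), ← hpk]; exact hqf
    have := onGrid_of_isFloat_of_le_abs (hfl _).1 hle
    rwa [show (p : ℤ) + k - p + 1 = k + 1 by ring] at this
  have hqgrid : OnGrid ((2 : ℚ) ^ (k + 1)) ((2 : ℚ) ^ p * (2 : ℚ) ^ k) := by
    refine ⟨2 ^ (p - 1), ?_⟩
    obtain ⟨r, rfl⟩ : ∃ r, p = r + 1 := ⟨p - 1, by omega⟩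
    rw [Nat.add_sub_cancel, hk1, pow_succ]; push_cast; ring
  obtain ⟨j, hj⟩ := hfgrid.sub hqgrid
  have hj0 : (0 : ℚ) ≤ j := by
    have : 0 * (2 : ℚ) ^ (k + 1) ≤ (j : ℚ) * (2 : ℚ) ^ (k + 1) := by rw [← hj, zero_mul]; linarith
    exact le_of_mul_le_mul_right this (two_zpow_pos _)
  have hj1 : (j : ℚ) ≤ 1 := by
    have : (j : ℚ) * (2 : ℚ) ^ (k + 1) ≤ 1 * (2 : ℚ) ^ (k + 1) := by rw [← hj, one_mul]; linarith
    exact le_of_mul_le_mul_right this (two_zpow_pos _)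
  have h0 : (0 : ℤ) ≤ j := by exact_mod_cast hj0
  have h1 : j ≤ 1 := by exact_mod_cast hj1
  rcases (show j = 0 ∨ j = 1 by omega) with rfl | rfl
  · left; simpa [sub_eq_zero] using hj
  · right; rw [Int.cast_one, one_mul] at hj; linarith

/-- A nonzero float below `2^e` in magnitude has `e > emin` (`|f| ≥ eta`).
[cite: RumpOgitaOishi2008, §2 (p. 192, eta)] -/
theorem emin_lt_of_abs_lt_two_zpow {x : ℚ} (hx : IsFloat p emin x) (hx0 : x ≠ 0) {e : ℤ}
    (h : |x| < (2 : ℚ) ^ e) : emin < e :=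
  (zpow_lt_zpow_iff_right₀ (by norm_num : (1 : ℚ) < 2)).mp ((two_zpow_emin_le_abs hx hx0).trans_lt h)

/-- `p > 0` not a power of 2, `2^E < p < 2^(E+1)`: `L = fl(|(q + p) − q|) = fl(q + p) − q = 2^(E+1) = 2ufp(p)`
("by Lemma 2.6 the computation of `fl(x − q)` causes no rounding error").
[cite: RumpOgitaOishi2008, Theorem 3.7 (proof)] -/
theorem nextPowerTwoL_eq_of_lt (hp : 1 ≤ p) (hfl : IsRoundNearest p emin fl) {x : ℚ}
    (hx : IsFloat p emin x) {E : ℤ} (hEx : (2 : ℚ) ^ E < x) (hxE : x < (2 : ℚ) ^ (E + 1)) :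
    nextPowerTwoL fl p x = (2 : ℚ) ^ (E + 1) := by
  have hx0 : 0 < x := (two_zpow_pos E).trans hEx
  have hE : emin < E + 1 := emin_lt_of_abs_lt_two_zpow hx hx0.ne' (by rwa [abs_of_pos hx0])
  rw [nextPowerTwoL, fl_two_pow_mul hfl hx, fl_two_pow_mul_add_sub_eq hp hfl hx hEx hxE,
    fl_eq_self hfl (isFloat_two_zpow hp hE.le), abs_of_pos (two_zpow_pos _)]

/-- `p = 2^k`: `L = fl(|(q + p) − q|) = fl(q + p) − q ∈ {0, 2^(k+1)}` exactly, according as the midpoint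
`q + p` is rounded to `q` or to `succ(q) = q + 2p`. [cite: RumpOgitaOishi2008, Theorem 3.7 (proof, first case)] -/
theorem nextPowerTwoL_two_zpow (hp : 1 ≤ p) (hfl : IsRoundNearest p emin fl) {k : ℤ} (hk : emin ≤ k) :
    nextPowerTwoL fl p ((2 : ℚ) ^ k) = fl (2 ^ p * (2 : ℚ) ^ k + (2 : ℚ) ^ k) - 2 ^ p * (2 : ℚ) ^ k ∧
      (nextPowerTwoL fl p ((2 : ℚ) ^ k) = 0 ∨ nextPowerTwoL fl p ((2 : ℚ) ^ k) = (2 : ℚ) ^ (k + 1)) := by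
  have key : nextPowerTwoL fl p ((2 : ℚ) ^ k) =
      |fl (fl (2 ^ p * (2 : ℚ) ^ k + (2 : ℚ) ^ k) - 2 ^ p * (2 : ℚ) ^ k)| := by
    rw [nextPowerTwoL, fl_two_pow_mul hfl (isFloat_two_zpow hp hk)]
  rcases fl_two_pow_mul_add_eq_or hp hfl hk with h | h
  · rw [key, h, sub_self, fl_eq_self hfl (isFloat_zero p emin), abs_zero]
    exact ⟨rfl, Or.inl rfl⟩
  · rw [key, h, add_sub_cancel_left, fl_eq_self hfl (isFloat_two_zpow hp (by omega)),
      abs_of_pos (two_zpow_pos _)]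
    exact ⟨rfl, Or.inr rfl⟩

/-! ### Theorem 3.7 -/

/-- **THEOREM 3.7, the case "`p` not a power of 2" — for EVERY rounding to nearest (any tie rule,
underflow allowed, no overflow in this model):** for `p ∈ F` with `ufp(p) < |p|`, `NextPowerTwo(p) = 2ufp(p)
= 2^⌈log₂|p|⌉`. [cite: RumpOgitaOishi2008, Theorem 3.7] -/
theorem nextPowerTwo_eq_of_ufp_lt (hp : 1 ≤ p) (hfl : IsRoundNearest p emin fl) {x : ℚ}
    (hx : IsFloat p emin x) (hux : ufp x < |x|) :
    nextPowerTwo fl p x = 2 * ufp x ∧ nextPowerTwo fl p x = 2 ^ Int.clog 2 |x| := by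
  have hx0 : x ≠ 0 := by
    intro h; rw [h, ufp_zero, abs_zero] at hux; exact lt_irrefl _ hux
  have hxpos : 0 < |x| := abs_pos.mpr hx0
  set E : ℤ := Int.log 2 |x| with hE
  have hux' : (2 : ℚ) ^ E < |x| := by rwa [ufp_of_ne_zero hx0] at hux
  have hxE : |x| < (2 : ℚ) ^ (E + 1) := abs_lt_zpow_log_succ x
  have hL : nextPowerTwoL fl p x = (2 : ℚ) ^ (E + 1) := by
    rcases lt_or_gt_of_ne hx0 with hneg | hpos
    · have h := nextPowerTwoL_neg fl p (-x)
      rw [neg_neg] at h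
      rw [h]
      rw [abs_of_neg hneg] at hux' hxE
      exact nextPowerTwoL_eq_of_lt hp hfl.neg hx.neg hux' hxE
    · rw [abs_of_pos hpos] at hux' hxE
      exact nextPowerTwoL_eq_of_lt hp hfl hx hux' hxE
  have hne : nextPowerTwoL fl p x ≠ 0 := by rw [hL]; exact two_zpow_ne_zero _
  rw [nextPowerTwo, if_neg hne, hL]
  constructor
  · rw [ufp_of_ne_zero hx0, zpow_add_one₀ (by norm_num : (2 : ℚ) ≠ 0), mul_comm]
  · have hclog : Int.clog 2 |x| = E + 1 := by
      apply le_antisymm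
      · exact (Int.le_zpow_iff_clog_le (R := ℚ) (b := 2) (by norm_num) hxpos).mp (by exact_mod_cast hxE.le)
      · have := (Int.zpow_lt_iff_lt_clog (R := ℚ) (b := 2) (by norm_num) hxpos).mp
          (by exact_mod_cast hux')
        omega
    rw [hclog]

/-- `p = 2^k`, any rounding to nearest: `NextPowerTwo(p) ∈ {2^k, 2^(k+1)}`, and `NextPowerTwo(p) = 2^k`
iff the midpoint `q + p = q(1 + eps)` is rounded to `q`. [cite: RumpOgitaOishi2008, Theorem 3.7 (proof, first case)] -/
theorem nextPowerTwo_two_zpow (hp : 1 ≤ p) (hfl : IsRoundNearest p emin fl) {k : ℤ} (hk : emin ≤ k) :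
    (nextPowerTwo fl p ((2 : ℚ) ^ k) = (2 : ℚ) ^ k ∨ nextPowerTwo fl p ((2 : ℚ) ^ k) = (2 : ℚ) ^ (k + 1)) ∧
      (nextPowerTwo fl p ((2 : ℚ) ^ k) = (2 : ℚ) ^ k ↔
        fl (2 ^ p * (2 : ℚ) ^ k + (2 : ℚ) ^ k) = 2 ^ p * (2 : ℚ) ^ k) := by
  obtain ⟨hLeq, hL⟩ := nextPowerTwoL_two_zpow hp hfl hk
  have hk1 : (2 : ℚ) ^ (k + 1) ≠ (2 : ℚ) ^ k := by
    rw [zpow_add_one₀ (by norm_num : (2 : ℚ) ≠ 0)]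
    have := two_zpow_pos k
    intro h; linarith
  rcases hL with h0 | h1
  · have hval : nextPowerTwo fl p ((2 : ℚ) ^ k) = (2 : ℚ) ^ k := by
      rw [nextPowerTwo, if_pos h0, abs_of_pos (two_zpow_pos k)]
    refine ⟨Or.inl hval, iff_of_true hval ?_⟩
    rw [hLeq] at h0
    linarith
  · have hval : nextPowerTwo fl p ((2 : ℚ) ^ k) = (2 : ℚ) ^ (k + 1) := by
      rw [nextPowerTwo, if_neg (by rw [h1]; exact two_zpow_ne_zero _), h1]
    refine ⟨Or.inr hval, iff_of_false (by rw [hval]; exact hk1) ?_⟩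
    rw [hLeq] at h1
    intro h
    rw [h, sub_self] at h1
    exact two_zpow_ne_zero _ h1.symm

/-- `|p| = 2^k` (either sign), any rounding to nearest: `NextPowerTwo(p) ∈ {2^k, 2^(k+1)}`, with
`NextPowerTwo(p) = 2^k = 2^⌈log₂|p|⌉` iff `fl(q + p) = q` for `q = eps⁻¹p` ("rounding tie to even … is
mandatory"). [cite: RumpOgitaOishi2008, Theorem 3.7 (proof, first case, and the Remark before it)] -/
theorem nextPowerTwo_of_abs_eq_two_zpow (hp : 1 ≤ p) (hfl : IsRoundNearest p emin fl) {x : ℚ} {k : ℤ}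
    (hk : emin ≤ k) (hxk : |x| = (2 : ℚ) ^ k) :
    (nextPowerTwo fl p x = (2 : ℚ) ^ k ∨ nextPowerTwo fl p x = (2 : ℚ) ^ (k + 1)) ∧
      (nextPowerTwo fl p x = (2 : ℚ) ^ k ↔ fl (2 ^ p * x + x) = 2 ^ p * x) := by
  rcases (abs_eq (two_zpow_pos k).le).mp hxk with h | h
  · rw [h]; exact nextPowerTwo_two_zpow hp hfl hk
  · rw [h, nextPowerTwo_neg]
    obtain ⟨h1, h2⟩ := nextPowerTwo_two_zpow hp hfl.neg hk
    refine ⟨h1, h2.trans ?_⟩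
    rw [show (2 : ℚ) ^ p * -(2 : ℚ) ^ k + -(2 : ℚ) ^ k = -(2 ^ p * (2 : ℚ) ^ k + (2 : ℚ) ^ k) by ring,
      mul_neg, neg_eq_iff_eq_neg]

/-! ### Theorem 3.7 for IEEE 754 rounding to nearest, ties to even -/

/-- Bookkeeping for midpoints: if `t = u·(N + ½)` with `u > 0` and `N ∈ ℤ`, then `⌊t/u⌋ = N` and `t` is
equidistant from `N·u` and `(N + 1)·u`. [cite: BoldoEtAl2023, §2.2 ("ties-to-even")] -/
theorem floor_div_eq_and_tie {t u : ℚ} (hu : 0 < u) {N : ℤ} (ht : t = u * (N + 1 / 2)) :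
    ⌊t / u⌋ = N ∧ t - (⌊t / u⌋ : ℚ) * u = ((⌊t / u⌋ : ℚ) + 1) * u - t := by
  have hdiv : t / u = N + 1 / 2 := by rw [ht, mul_div_cancel_left₀ _ hu.ne']
  have hfl : ⌊t / u⌋ = N := by
    rw [hdiv, Int.floor_eq_iff]; constructor <;> linarith
  refine ⟨hfl, ?_⟩
  rw [hfl, ht]; ring

/-- `ulp(q(1 + eps)) = 2eps·ufp(q) = 2^(k+1)` for `q = eps⁻¹·2^k = 2^(p+k)` (`q ∉ U`).
[cite: RumpOgitaOishi2008, Theorem 3.7 (proof, first case)] -/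
theorem ulp_two_pow_mul_add_self (hp : 1 ≤ p) {k : ℤ} (hk : emin ≤ k) :
    ulp p emin (2 ^ p * (2 : ℚ) ^ k + (2 : ℚ) ^ k) = (2 : ℚ) ^ (k + 1) := by
  have h2 : (2 : ℚ) ≠ 0 := by norm_num
  have hpk : (2 : ℚ) ^ p * (2 : ℚ) ^ k = (2 : ℚ) ^ ((p : ℤ) + k) := by rw [← zpow_natCast, ← zpow_add₀ h2]
  have h2k := two_zpow_pos k
  have hpos : 0 < 2 ^ p * (2 : ℚ) ^ k + (2 : ℚ) ^ k := by positivity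
  have habs : |2 ^ p * (2 : ℚ) ^ k + (2 : ℚ) ^ k| = 2 ^ p * (2 : ℚ) ^ k + (2 : ℚ) ^ k := abs_of_pos hpos
  have hlo : (2 : ℚ) ^ ((p : ℤ) + k) ≤ |2 ^ p * (2 : ℚ) ^ k + (2 : ℚ) ^ k| := by
    rw [habs, ← hpk]; linarith
  have hhi : |2 ^ p * (2 : ℚ) ^ k + (2 : ℚ) ^ k| < (2 : ℚ) ^ ((p : ℤ) + k + 1) := by
    rw [habs, zpow_add_one₀ h2, ← hpk]
    have h1 : (1 : ℚ) < 2 ^ p := one_lt_pow₀ (by norm_num) (by omega)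
    have : 1 * (2 : ℚ) ^ k < 2 ^ p * (2 : ℚ) ^ k := mul_lt_mul_of_pos_right h1 h2k
    linarith
  have hU : (2 : ℚ) ^ (emin + p - 1) ≤ |2 ^ p * (2 : ℚ) ^ k + (2 : ℚ) ^ k| :=
    (zpow_le_zpow_right₀ (by norm_num) (by omega)).trans hlo
  rw [ulp_eq_two_mul_u_mul_ufp hU, ufp_eq_two_zpow_of_le_of_lt hlo hhi, two_mul_u_mul_two_zpow]
  congr 1; ring

/-- **Ties to even at `q(1 + eps)`, `q = eps⁻¹p`, `p = 2^k`:** the scaled significand `⌊t/ulp(t)⌋ = 2^(p-1)`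
of the lower neighbour `q` is even (`p ≥ 2`), so `RN_e(q + p) = q`.
[cite: RumpOgitaOishi2008, Theorem 3.7 (proof, first case)] -/
theorem roundTiesEven_two_pow_mul_add (hp : 2 ≤ p) {k : ℤ} (hk : emin ≤ k) :
    roundTiesEven p emin (2 ^ p * (2 : ℚ) ^ k + (2 : ℚ) ^ k) = 2 ^ p * (2 : ℚ) ^ k := by
  have h2 : (2 : ℚ) ≠ 0 := by norm_num
  have hulp := ulp_two_pow_mul_add_self (emin := emin) (show 1 ≤ p by omega) hk
  obtain ⟨r, rfl⟩ : ∃ r, p = r + 1 := ⟨p - 1, by omega⟩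
  have hr : r ≠ 0 := by omega
  set t : ℚ := 2 ^ (r + 1) * (2 : ℚ) ^ k + (2 : ℚ) ^ k with ht
  have hk1 : (2 : ℚ) ^ (k + 1) = (2 : ℚ) ^ k * 2 := zpow_add_one₀ h2 k
  have htN : t = ulp (r + 1) emin t * (((2 ^ r : ℤ) : ℚ) + 1 / 2) := by
    rw [hulp, hk1, ht, pow_succ]; push_cast; ring
  obtain ⟨hfloor, htie⟩ := floor_div_eq_and_tie (ulp_pos t) htN
  have heven : Even ((2 : ℤ) ^ r) := (Int.even_pow' hr).mpr even_two
  rw [roundTiesEven_of_tie htie, hfloor, if_pos heven, hulp, hk1, pow_succ]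
  push_cast; ring

/-- The same at `−q(1 + eps)`: `⌊t/ulp(t)⌋ = −2^(p-1) − 1` is odd, so `RN_e` returns the upper neighbour
`−q`: `RN_e(q + p) = q` for `p = −2^k`, `q = eps⁻¹p` as well.
[cite: RumpOgitaOishi2008, Theorem 3.7 (proof, first case)] -/
theorem roundTiesEven_two_pow_mul_neg_add (hp : 2 ≤ p) {k : ℤ} (hk : emin ≤ k) :
    roundTiesEven p emin (2 ^ p * -(2 : ℚ) ^ k + -(2 : ℚ) ^ k) = 2 ^ p * -(2 : ℚ) ^ k := by
  have h2 : (2 : ℚ) ≠ 0 := by norm_num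
  have hulp : ulp p emin (2 ^ p * -(2 : ℚ) ^ k + -(2 : ℚ) ^ k) = (2 : ℚ) ^ (k + 1) := by
    rw [show (2 : ℚ) ^ p * -(2 : ℚ) ^ k + -(2 : ℚ) ^ k = -(2 ^ p * (2 : ℚ) ^ k + (2 : ℚ) ^ k) by ring,
      ulp_neg]
    exact ulp_two_pow_mul_add_self (show 1 ≤ p by omega) hk
  obtain ⟨r, rfl⟩ : ∃ r, p = r + 1 := ⟨p - 1, by omega⟩
  have hr : r ≠ 0 := by omega
  set t : ℚ := 2 ^ (r + 1) * -(2 : ℚ) ^ k + -(2 : ℚ) ^ k with ht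
  have hk1 : (2 : ℚ) ^ (k + 1) = (2 : ℚ) ^ k * 2 := zpow_add_one₀ h2 k
  have htN : t = ulp (r + 1) emin t * (((-(2 ^ r + 1) : ℤ) : ℚ) + 1 / 2) := by
    rw [hulp, hk1, ht, pow_succ]; push_cast; ring
  obtain ⟨hfloor, htie⟩ := floor_div_eq_and_tie (ulp_pos t) htN
  have hodd : Odd (-(2 ^ r + 1) : ℤ) := (((Int.even_pow' hr).mpr even_two).add_one).neg
  obtain ⟨hval, -⟩ := roundTiesEven_of_tie_of_odd htie (by rwa [hfloor])
  rw [hval, hfloor, hulp, hk1, pow_succ]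
  push_cast; ring

/-- **THEOREM 3.7.** Let `L` be the result of Algorithm 3.6 (`NextPowerTwo`) applied to a nonzero
floating-point number `p`, in IEEE 754 rounding to nearest, TIES TO EVEN (`roundTiesEven`), precision
`p ≥ 2`. Then `L = 2^⌈log₂|p|⌉` — "also in the presence of underflow"; no overflow occurs in this model.
(For `p = 1` every float is `±2^k`, the scaled significand `2^(p-1) = 1` of `q` is odd, and `L = 2|p|`.)
[cite: RumpOgitaOishi2008, Theorem 3.7] -/
theorem nextPowerTwo_roundTiesEven (hp : 2 ≤ p) {x : ℚ} (hx : IsFloat p emin x) (hx0 : x ≠ 0) :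
    nextPowerTwo (roundTiesEven p emin) p x = 2 ^ Int.clog 2 |x| := by
  have hp1 : 1 ≤ p := by omega
  have hfl := isRoundNearest_roundTiesEven (p := p) (emin := emin) hp1
  rcases (ufp_le_abs x).lt_or_eq with hlt | heq
  · exact (nextPowerTwo_eq_of_ufp_lt hp1 hfl hx hlt).2
  · set E : ℤ := Int.log 2 |x| with hE
    have hxE : |x| = (2 : ℚ) ^ E := by rw [← heq, ufp_of_ne_zero hx0]
    have hEk : emin ≤ E :=
      (zpow_le_zpow_iff_right₀ (by norm_num : (1 : ℚ) < 2)).mp (hxE ▸ two_zpow_emin_le_abs hx hx0)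
    have hclog : Int.clog 2 |x| = E := by
      rw [hxE]; exact_mod_cast Int.clog_zpow (R := ℚ) (b := 2) (by norm_num) E
    rw [hclog]
    refine (nextPowerTwo_of_abs_eq_two_zpow hp1 hfl hEk hxE).2.mpr ?_
    rcases (abs_eq (two_zpow_pos E).le).mp hxE with h | h
    · rw [h]; exact roundTiesEven_two_pow_mul_add hp hEk
    · rw [h]; exact roundTiesEven_two_pow_mul_neg_add hp hEk

/-- The hypothesis `p ≥ 2` of `nextPowerTwo_roundTiesEven` is needed: in precision `p = 1` (where every
float is `±2^k`) the scaled significand `2^(p-1) = 1` of `q` is odd, ties-to-even rounds `q(1 + eps)` UP to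
`2q`, and Algorithm 3.6 returns `L = 2^(k+1) = 2|p| ≠ 2^⌈log₂|p|⌉`.
[cite: RumpOgitaOishi2008, Theorem 3.7 (scope: precision 1)] -/
theorem nextPowerTwo_roundTiesEven_prec_one {k : ℤ} (hk : emin ≤ k) :
    nextPowerTwo (roundTiesEven 1 emin) 1 ((2 : ℚ) ^ k) = (2 : ℚ) ^ (k + 1) := by
  have h2 : (2 : ℚ) ≠ 0 := by norm_num
  have hfl := isRoundNearest_roundTiesEven (p := 1) (emin := emin) le_rfl
  obtain ⟨hor, hiff⟩ := nextPowerTwo_two_zpow (fl := roundTiesEven 1 emin) le_rfl hfl hk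
  refine hor.resolve_left fun h => ?_
  have hq := hiff.mp h
  -- at `t = 2·2^k + 2^k`: `ulp(t) = 2^(k+1)`, `⌊t/ulp(t)⌋ = 1` is odd, so `RN_e(t) = 2·2^(k+1) ≠ q`
  have hulp := ulp_two_pow_mul_add_self (p := 1) (emin := emin) le_rfl hk
  set t : ℚ := 2 ^ 1 * (2 : ℚ) ^ k + (2 : ℚ) ^ k with ht
  have hk1 : (2 : ℚ) ^ (k + 1) = (2 : ℚ) ^ k * 2 := zpow_add_one₀ h2 k
  have htN : t = ulp 1 emin t * (((1 : ℤ) : ℚ) + 1 / 2) := by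
    rw [hulp, hk1, ht]; push_cast; ring
  obtain ⟨hfloor, htie⟩ := floor_div_eq_and_tie (ulp_pos t) htN
  obtain ⟨hval, -⟩ := roundTiesEven_of_tie_of_odd htie (by rw [hfloor]; exact odd_one)
  rw [hval, hfloor, hulp, hk1] at hq
  have := two_zpow_pos k
  push_cast at hq
  linarith

/-- **"Rounding tie to even … is mandatory"** (the Remark before the proof): for every power of two
`p = 2^k ∈ F` there is a rounding to nearest (differing from `RN_e` only in the tie at `q(1 + eps)`, which
it rounds AWAY from zero) under which Algorithm 3.6 returns `L = 2^(k+1) ≠ 2^⌈log₂|p|⌉`.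
[cite: RumpOgitaOishi2008, Theorem 3.7 (Remark)] -/
theorem exists_isRoundNearest_nextPowerTwo_ne (hp : 1 ≤ p) {k : ℤ} (hk : emin ≤ k) :
    ∃ fl : ℚ → ℚ, IsRoundNearest p emin fl ∧ nextPowerTwo fl p ((2 : ℚ) ^ k) = (2 : ℚ) ^ (k + 1) ∧
      nextPowerTwo fl p ((2 : ℚ) ^ k) ≠ 2 ^ Int.clog 2 |(2 : ℚ) ^ k| := by
  have h2 : (2 : ℚ) ≠ 0 := by norm_num
  have h2k := two_zpow_pos k
  have hk1 : (2 : ℚ) ^ (k + 1) = (2 : ℚ) ^ k * 2 := zpow_add_one₀ h2 k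
  set q : ℚ := 2 ^ p * (2 : ℚ) ^ k with hq
  set g : ℚ := q + (2 : ℚ) ^ (k + 1) with hg
  -- `g = succ(q) = (2^(p-1) + 1)·2^(k+1) ∈ F`
  have hgF : IsFloat p emin g := by
    obtain ⟨r, rfl⟩ : ∃ r, p = r + 1 := ⟨p - 1, by omega⟩
    have hN : |((2 : ℤ) ^ r + 1)| ≤ (2 : ℤ) ^ (r + 1) := by
      rw [abs_of_pos (by positivity), pow_succ]
      have : (1 : ℤ) ≤ 2 ^ r := one_le_pow₀ (by norm_num)
      linarith
    have := isFloat_of_abs_le (emin := emin) (by omega : 1 ≤ r + 1) hN (by omega : emin ≤ k + 1)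
    convert this using 1
    rw [hg, hq, hk1, pow_succ]; push_cast; ring
  have hfl₀ := isRoundNearest_roundTiesEven (p := p) (emin := emin) hp
  -- at the midpoint `t₀ = q + 2^k`, `RN_e(t₀) ∈ {q, g}` is at distance `2^k`, and so is `g`
  have hdist : ∀ f : ℚ, IsFloat p emin f → |q + (2 : ℚ) ^ k - g| ≤ |q + (2 : ℚ) ^ k - f| := by
    intro f hf
    have h1 := (hfl₀ (q + (2 : ℚ) ^ k)).2 f hf
    have hdg : |q + (2 : ℚ) ^ k - g| = (2 : ℚ) ^ k := by
      rw [hg, hk1, show q + (2 : ℚ) ^ k - (q + (2 : ℚ) ^ k * 2) = -(2 : ℚ) ^ k by ring, abs_neg, abs_of_pos h2k]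
    have hd₀ : |q + (2 : ℚ) ^ k - roundTiesEven p emin (q + (2 : ℚ) ^ k)| = (2 : ℚ) ^ k := by
      rcases fl_two_pow_mul_add_eq_or hp hfl₀ hk with h | h
      · rw [h, add_sub_cancel_left, abs_of_pos h2k]
      · rw [h, ← hg]; exact hdg
    exact hdg.trans_le (hd₀.symm.trans_le h1)
  refine ⟨fun t => if t = q + (2 : ℚ) ^ k then g else roundTiesEven p emin t, ?_, ?_⟩
  · intro t
    by_cases ht : t = q + (2 : ℚ) ^ k
    · simp only [ht, if_true]
      exact ⟨hgF, hdist⟩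
    · simp only [ht, if_false]
      exact hfl₀ t
  · set fl₁ : ℚ → ℚ := fun t => if t = q + (2 : ℚ) ^ k then g else roundTiesEven p emin t with hfl₁
    have hfl₁N : IsRoundNearest p emin fl₁ := by
      intro t
      by_cases ht : t = q + (2 : ℚ) ^ k
      · simp only [hfl₁, ht, if_true]; exact ⟨hgF, hdist⟩
      · simp only [hfl₁, ht, if_false]; exact hfl₀ t
    obtain ⟨hor, hiff⟩ := nextPowerTwo_two_zpow hp hfl₁N hk
    have hne : nextPowerTwo fl₁ p ((2 : ℚ) ^ k) ≠ (2 : ℚ) ^ k := by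
      rw [Ne, hiff]
      simp only [hfl₁, ← hq, if_true, hg, hk1]
      linarith
    have hval : nextPowerTwo fl₁ p ((2 : ℚ) ^ k) = (2 : ℚ) ^ (k + 1) := hor.resolve_left hne
    refine ⟨hval, ?_⟩
    rw [hval, abs_of_pos h2k]
    have hclog : Int.clog 2 ((2 : ℚ) ^ k) = k := by
      exact_mod_cast Int.clog_zpow (R := ℚ) (b := 2) (by norm_num) k
    rw [hclog, hk1]
    linarith

/-- **Theorem 3.7 for every rounding to nearest** (the tie rule enters only for powers of two):
`NextPowerTwo(p) = 2^⌈log₂|p|⌉`, or `|p| = ufp(p)` is a power of two and `NextPowerTwo(p) = 2^(⌈log₂|p|⌉+1)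
= 2|p|`; in all cases `NextPowerTwo(p)` is a power of two with `|p| ≤ NextPowerTwo(p) ≤ 2^(⌈log₂|p|⌉+1)`.
[cite: RumpOgitaOishi2008, Theorem 3.7 (and the Remark)] -/
theorem nextPowerTwo_eq_or (hp : 1 ≤ p) (hfl : IsRoundNearest p emin fl) {x : ℚ} (hx : IsFloat p emin x)
    (hx0 : x ≠ 0) :
    nextPowerTwo fl p x = 2 ^ Int.clog 2 |x| ∨
      (|x| = ufp x ∧ nextPowerTwo fl p x = 2 ^ (Int.clog 2 |x| + 1)) := by
  rcases (ufp_le_abs x).lt_or_eq with hlt | heq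
  · exact Or.inl (nextPowerTwo_eq_of_ufp_lt hp hfl hx hlt).2
  · set E : ℤ := Int.log 2 |x| with hE
    have hxE : |x| = (2 : ℚ) ^ E := by rw [← heq, ufp_of_ne_zero hx0]
    have hEk : emin ≤ E :=
      (zpow_le_zpow_iff_right₀ (by norm_num : (1 : ℚ) < 2)).mp (hxE ▸ two_zpow_emin_le_abs hx hx0)
    have hclog : Int.clog 2 |x| = E := by
      rw [hxE]; exact_mod_cast Int.clog_zpow (R := ℚ) (b := 2) (by norm_num) E
    rw [hclog]
    rcases (nextPowerTwo_of_abs_eq_two_zpow hp hfl hEk hxE).1 with h | h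
    · exact Or.inl h
    · exact Or.inr ⟨heq.symm, h⟩

/-! ### Theorem 4.8: the number of passes of `Transform` in terms of the condition number -/

/-- Eq. (4.25): the condition number of summation, `cond(Σ pᵢ) = Σ|pᵢ| / |Σ pᵢ|` (for `Σ pᵢ ≠ 0`; the
`lim sup` definition of [19] evaluates to this, "obviously"). [cite: RumpOgitaOishi2008, eq. (4.25)] -/
def condSum (xs : List ℚ) : ℚ := (xs.map abs).sum / |xs.sum|

/-- The number `m` of executions of the "repeat–until"-loop of Algorithm 4.1 (`Transform`), counted along
the recursion of `transformAux` (same state, same stopping test, same fuel; `0` if the fuel is `0`).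
[cite: RumpOgitaOishi2008, Theorem 4.8 ("stops after at most m executions of the repeat-until-loop")] -/
def transformCount (fl : ℚ → ℚ) (M : ℕ) (u eta₂ : ℚ) : ℕ → ℚ → ℚ → List ℚ → ℕ
  | 0, _, _, _ => 0
  | fuel + 1, t, σ, xs =>
      if fl (2 ^ (2 * M) * u * σ) ≤ |fl (t + (extractVector fl σ xs).1)| ∨ σ ≤ eta₂ then 1
      else
        transformCount fl M u eta₂ fuel (fl (t + (extractVector fl σ xs).1)) (fl (2 ^ M * u * σ))
          (extractVector fl σ xs).2 + 1

/-- The number of executions of the "repeat–until"-loop when `Transform` (Algorithm 4.1, as typed in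
`transform`) is applied to `p` (`0` for the zero vector, which returns before the loop).
[cite: RumpOgitaOishi2008, Theorem 4.8] -/
def transformPasses (fl : ℚ → ℚ) (p : ℕ) (emin : ℤ) (xs : List ℚ) : ℕ :=
  if maxAbs xs = 0 then 0
  else
    transformCount fl (Nat.clog 2 (xs.length + 2)) (unitRoundoff p) ((2 : ℚ) ^ (emin + p - 1))
      (((Nat.clog 2 (xs.length + 2) : ℤ) + Int.clog 2 (maxAbs xs) - emin).toNat + 1) 0
      ((2 : ℚ) ^ ((Nat.clog 2 (xs.length + 2) : ℤ) + Int.clog 2 (maxAbs xs))) xs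

/-- The pass count never exceeds the fuel. [cite: RumpOgitaOishi2008, Algorithm 4.1] -/
theorem transformCount_le_fuel (fl : ℚ → ℚ) (M : ℕ) (u eta₂ : ℚ) :
    ∀ (fuel : ℕ) (t σ : ℚ) (xs : List ℚ), transformCount fl M u eta₂ fuel t σ xs ≤ fuel
  | 0, _, _, _ => le_rfl
  | fuel + 1, t, σ, xs => by
      simp only [transformCount]
      split_ifs
      · omega
      · exact Nat.succ_le_succ (transformCount_le_fuel fl M u eta₂ fuel _ _ _)

/-- The count is the number of passes actually performed: running the loop with exactly that much fuel
returns the same results `[τ₁, τ₂, p⁽ᵐ⁾, σ]`. [cite: RumpOgitaOishi2008, Algorithm 4.1] -/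
theorem transformAux_count_eq (fl : ℚ → ℚ) (M : ℕ) (u eta₂ : ℚ) :
    ∀ (fuel : ℕ) (t σ : ℚ) (xs : List ℚ),
      transformAux fl M u eta₂ (transformCount fl M u eta₂ fuel t σ xs) t σ xs =
        transformAux fl M u eta₂ fuel t σ xs
  | 0, _, _, _ => rfl
  | fuel + 1, t, σ, xs => by
      simp only [transformCount]
      split_ifs with h
      · simp only [transformAux, if_pos h]
      · simp only [transformAux, if_neg h]
        exact transformAux_count_eq fl M u eta₂ fuel _ _ _

/-- With positive fuel at least one pass is executed (a "repeat–until"-loop runs its body once).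
[cite: RumpOgitaOishi2008, Algorithm 4.1] -/
theorem one_le_transformCount (fl : ℚ → ℚ) (M : ℕ) (u eta₂ : ℚ) (fuel : ℕ) (t σ : ℚ) (xs : List ℚ) :
    1 ≤ transformCount fl M u eta₂ (fuel + 1) t σ xs := by
  simp only [transformCount]
  split_ifs <;> omega

/-- For a nonzero vector, `Transform` executes the loop `m = transformPasses ≥ 1` times.
[cite: RumpOgitaOishi2008, Theorem 4.8] -/
theorem one_le_transformPasses {xs : List ℚ} (hne : maxAbs xs ≠ 0) : 1 ≤ transformPasses fl p emin xs := by
  rw [transformPasses, if_neg hne]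
  exact one_le_transformCount _ _ _ _ _ _ _ _

/-- `transformPasses` IS the number of passes of `transform`: the results of `Transform` are those of the
loop run for exactly `transformPasses` passes. [cite: RumpOgitaOishi2008, Theorem 4.8] -/
theorem transform_eq_transformAux_passes {xs : List ℚ} (hne : maxAbs xs ≠ 0) :
    transform fl p emin xs =
      transformAux fl (Nat.clog 2 (xs.length + 2)) (unitRoundoff p) ((2 : ℚ) ^ (emin + p - 1))
        (transformPasses fl p emin xs) 0
        ((2 : ℚ) ^ ((Nat.clog 2 (xs.length + 2) : ℤ) + Int.clog 2 (maxAbs xs))) xs := by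
  rw [transform, transformPasses, if_neg hne, if_neg hne, transformAux_count_eq]

/-- `μ = max |pᵢ| ≤ Σ|pᵢ|`. [cite: RumpOgitaOishi2008, Theorem 4.8 (proof, `|s| = C⁻¹Σ|pᵢ| ≥ μC⁻¹`)] -/
theorem maxAbs_le_sum_abs : ∀ xs : List ℚ, maxAbs xs ≤ (xs.map abs).sum
  | [] => le_rfl
  | x :: xs => by
      simp only [maxAbs, List.map_cons, List.sum_cons]
      have h0 : 0 ≤ (xs.map abs).sum := List.sum_nonneg (by
        intro a ha; obtain ⟨b, -, rfl⟩ := List.mem_map.mp ha; exact abs_nonneg b)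
      exact max_le (by linarith) (by linarith [maxAbs_le_sum_abs xs, abs_nonneg x])

/-- **THEOREM 4.8, the loop (eqs. (4.27)–(4.29)).** Entering a pass of Algorithm 4.1 in the state of
Lemma 4.2 (`σ = 2^k ≥ eta`, `p⁽ᵐ⁻¹⁾` of length `n`, `n + 2 ≤ 2^M`, entries in `F` bounded by `2^-M σ`,
`t ∈ F ∩ epsσℤ`, `s = t + Σ p⁽ᵐ⁻¹⁾ᵢ`, `2²ᴹeps ≤ 1`) and with `|t| < 2ᴹσ` (true initially, `t = 0`, and after
every continuing pass by (4.28)): if `|s| ≥ (2ᴹ + 1)·ϕᵐ·σ`, `ϕ = 2ᴹeps`, the loop stops within `m` more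
passes — for while it continues, `|t⁽ᵐ⁾| < 2²ᴹepsσₘ₋₁ = 2ᴹσₘ` (4.28) and `|Σ p⁽ᵐ⁾ᵢ| ≤ n·epsσₘ₋₁ < σₘ`, so (4.29)
`s = t⁽ᵐ⁾ + Σ p⁽ᵐ⁾ᵢ` forces `|s| < (2ᴹ + 1)σₘ = (2ᴹ + 1)ϕᵐσ₀`.
[cite: RumpOgitaOishi2008, Theorem 4.8 (proof, eqs. (4.27)–(4.29))] -/
theorem transformCount_le_of_le_abs (hp : 1 ≤ p) (hfl : IsRoundNearest p emin fl) {M : ℕ}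
    (h2M : 2 * M ≤ p) {n : ℕ} (hnM : n + 2 ≤ 2 ^ M) (s : ℚ) :
    ∀ (fuel m : ℕ) (t : ℚ) (k : ℤ) (xs : List ℚ), emin ≤ k → xs.length = n →
      (∀ x ∈ xs, IsFloat p emin x ∧ |x| ≤ (2 : ℚ) ^ (k - M)) → IsFloat p emin t →
      OnGrid (unitRoundoff p * (2 : ℚ) ^ k) t → s = t + xs.sum → |t| < 2 ^ M * (2 : ℚ) ^ k →
      (2 ^ M + 1) * (2 ^ M * unitRoundoff p) ^ m * (2 : ℚ) ^ k ≤ |s| →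
      transformCount fl M (unitRoundoff p) ((2 : ℚ) ^ (emin + p - 1)) fuel t ((2 : ℚ) ^ k) xs ≤ m
  | 0, m, _, _, _, _, _, _, _, _, _, _, _ => Nat.zero_le m
  | fuel + 1, m, t, k, xs, hk, hlen, hxs, ht, htg, hs, htlt, hsm => by
      have hM : M < p := by omega
      have h2 : (2 : ℚ) ≠ 0 := by norm_num
      have h2k := two_zpow_pos k
      have hupos := u_pos (p := p)
      have hnlt : xs.length < 2 ^ M := by rw [hlen]; omega
      have hdiv : (2 : ℚ) ^ k / 2 ^ M = (2 : ℚ) ^ (k - M) := by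
        rw [zpow_sub₀ h2, zpow_natCast]
      have hσk : (2 : ℚ) ^ k = (2 : ℚ) ^ M * (2 : ℚ) ^ (k - M) := by
        rw [← zpow_natCast, ← zpow_add₀ h2]; congr 1; ring
      -- `|Σ p⁽ᵐ⁻¹⁾ᵢ| ≤ n·2^-M σ < σ`, so `|s| < |t| + σ < (2ᴹ + 1)σ`: the hypothesis forces `m ≥ 1`
      have hsum_abs : |xs.sum| ≤ (n : ℚ) * (2 : ℚ) ^ (k - M) := by
        refine (abs_list_sum_le xs).trans ?_
        have := List.sum_le_card_nsmul (xs.map abs) ((2 : ℚ) ^ (k - M)) (by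
          intro a ha; obtain ⟨b, hb, rfl⟩ := List.mem_map.mp ha; exact (hxs b hb).2)
        rwa [List.length_map, hlen, nsmul_eq_mul] at this
      have hsum_lt : |xs.sum| < (2 : ℚ) ^ k := by
        have hn : (n : ℚ) < 2 ^ M := by exact_mod_cast (show n < 2 ^ M by omega)
        rw [hσk]
        exact hsum_abs.trans_lt (mul_lt_mul_of_pos_right hn (two_zpow_pos _))
      have hs_lt : |s| < (2 ^ M + 1) * (2 : ℚ) ^ k := by
        rw [hs]
        calc |t + xs.sum| ≤ |t| + |xs.sum| := abs_add_le _ _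
          _ < 2 ^ M * (2 : ℚ) ^ k + (2 : ℚ) ^ k := add_lt_add htlt hsum_lt
          _ = (2 ^ M + 1) * (2 : ℚ) ^ k := by ring
      cases m with
      | zero =>
          exfalso
          rw [pow_zero, mul_one] at hsm
          exact absurd (hsm.trans_lt hs_lt) (lt_irrefl _)
      | succ m =>
          have hxs' : ∀ x ∈ xs, IsFloat p emin x ∧ |x| ≤ (2 : ℚ) ^ k / 2 ^ M := by
            intro x hx; rw [hdiv]; exact hxs x hx
          obtain ⟨hsum, hlo, -, -, hτg, -, hτF⟩ := extractVector_eft hp hfl hk hM hxs' hnlt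
          simp only [transformCount]
          set τ : ℚ := (extractVector fl ((2 : ℚ) ^ k) xs).1 with hτdef
          set xs₁ : List ℚ := (extractVector fl ((2 : ℚ) ^ k) xs).2 with hxs₁def
          split_ifs with hstop
          · omega
          · -- the loop continues: (4.28) `|t⁽ᵐ⁾| < 2²ᴹepsσ = 2ᴹσ'`, `σ' = 2ᴹepsσ = 2^(k+M-p)`, `t⁽ᵐ⁾ = t + τ`
            obtain ⟨hlt, hσgt⟩ := not_or.mp hstop
            have hlt : |fl (t + τ)| < fl (2 ^ (2 * M) * unitRoundoff p * (2 : ℚ) ^ k) := not_le.mp hlt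
            have hσgt : (2 : ℚ) ^ (emin + p - 1) < (2 : ℚ) ^ k := not_le.mp hσgt
            have hkp : emin + p ≤ k := by
              by_contra hlt'
              have : (2 : ℚ) ^ k ≤ (2 : ℚ) ^ (emin + p - 1) :=
                zpow_le_zpow_right₀ (by norm_num) (by omega)
              exact absurd hσgt (not_lt.mpr this)
            have hρ : fl (2 ^ (2 * M) * unitRoundoff p * (2 : ℚ) ^ k) = (2 : ℚ) ^ (k + (2 * M : ℕ) - p) := by
              rw [two_pow_mul_u_mul_two_zpow]
              exact fl_eq_self hfl (isFloat_two_zpow hp (by push_cast; omega))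
            have hσ' : fl (2 ^ M * unitRoundoff p * (2 : ℚ) ^ k) = (2 : ℚ) ^ (k + M - p) := by
              rw [two_pow_mul_u_mul_two_zpow]
              exact fl_eq_self hfl (isFloat_two_zpow hp (by omega))
            have ht'lt : |fl (t + τ)| < (2 : ℚ) ^ k := by
              rw [hρ] at hlt
              exact hlt.trans_le (zpow_le_zpow_right₀ (by norm_num) (by push_cast; omega))
            have ht'eq : fl (t + τ) = t + τ := fl_add_eq_add_of_abs_fl_lt hp hfl ht hτF htg hτg ht'lt
            have hlen₁ : xs₁.length = n := by rw [hxs₁def, length_extractVector_snd, hlen]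
            have hxs₁F : ∀ x ∈ xs₁, IsFloat p emin x := isFloat_of_mem_extractVector_snd hfl _ xs
            have hk' : emin ≤ k + M - p := by omega
            have hxs₁' : ∀ x ∈ xs₁, IsFloat p emin x ∧ |x| ≤ (2 : ℚ) ^ (k + M - p - M) := by
              intro x hx
              refine ⟨hxs₁F x hx, ?_⟩
              have := hlo x hx
              rwa [u_mul_two_zpow, show k - (p : ℤ) = k + M - p - M by ring] at this
            have ht'g : OnGrid (unitRoundoff p * (2 : ℚ) ^ (k + M - p)) (fl (t + τ)) := by
              rw [ht'eq, u_mul_two_zpow]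
              have := htg.add hτg
              rw [u_mul_two_zpow] at this
              exact this.of_le (by omega)
            have hs' : s = fl (t + τ) + xs₁.sum := by rw [ht'eq, hs, hsum]; ring
            -- (4.28): `|t⁽ᵐ⁾| < 2²ᴹepsσ = 2ᴹ·σ'`
            have ht'M : |fl (t + τ)| < 2 ^ M * (2 : ℚ) ^ (k + M - p) := by
              rw [hρ] at hlt
              convert hlt using 1
              rw [← zpow_natCast, ← zpow_add₀ h2]; congr 1; push_cast; ring
            -- `(2ᴹ + 1)ϕ^(m+1)σ = (2ᴹ + 1)ϕᵐσ'`
            have hsm' : (2 ^ M + 1) * (2 ^ M * unitRoundoff p) ^ m * (2 : ℚ) ^ (k + M - p) ≤ |s| := by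
              rw [← two_pow_mul_u_mul_two_zpow]
              convert hsm using 1
              ring
            have IH := transformCount_le_of_le_abs hp hfl h2M hnM s fuel m (fl (t + τ)) (k + M - p) xs₁
              hk' hlen₁ hxs₁' (hfl _).1 ht'g hs' ht'M hsm'
            rw [hσ']
            exact Nat.succ_le_succ IH

/-- `Transform` applied to a nonzero vector: if `|s| ≥ (2ᴹ + 1)ϕᵐσ₀` (`σ₀ = 2^(M + ⌈log₂ μ⌉)`, `ϕ = 2ᴹeps`),
the "repeat–until"-loop is executed at most `m` times. [cite: RumpOgitaOishi2008, Theorem 4.8 (proof)] -/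
theorem transformPasses_le_of_le_abs (hp : 1 ≤ p) (hfl : IsRoundNearest p emin fl) {xs : List ℚ}
    (hxs : ∀ x ∈ xs, IsFloat p emin x) (hne : maxAbs xs ≠ 0) (h2M : 2 * Nat.clog 2 (xs.length + 2) ≤ p)
    {m : ℕ}
    (hsm : (2 ^ Nat.clog 2 (xs.length + 2) + 1) *
        (2 ^ Nat.clog 2 (xs.length + 2) * unitRoundoff p) ^ m *
          (2 : ℚ) ^ ((Nat.clog 2 (xs.length + 2) : ℤ) + Int.clog 2 (maxAbs xs)) ≤ |xs.sum|) :
    transformPasses fl p emin xs ≤ m := by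
  have hnM : xs.length + 2 ≤ 2 ^ Nat.clog 2 (xs.length + 2) := Nat.le_pow_clog (by norm_num) _
  obtain ⟨x, hx, hxμ⟩ := exists_abs_eq_maxAbs hne
  have hx0 : x ≠ 0 := by intro h; rw [h, abs_zero] at hxμ; exact hne hxμ.symm
  have hμeta : (2 : ℚ) ^ emin ≤ maxAbs xs := hxμ ▸ two_zpow_emin_le_abs (hxs x hx) hx0
  have hμK : maxAbs xs ≤ (2 : ℚ) ^ Int.clog 2 (maxAbs xs) := by
    have := Int.self_le_zpow_clog (R := ℚ) (b := 2) (by norm_num) (maxAbs xs); exact_mod_cast this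
  have heminK : emin ≤ Int.clog 2 (maxAbs xs) := by
    have h1 := Int.clog_mono_right (b := 2) (two_zpow_pos emin) hμeta
    have h2 : Int.clog 2 ((2 : ℚ) ^ emin) = emin := by
      have := Int.clog_zpow (R := ℚ) (b := 2) (by norm_num) emin; exact_mod_cast this
    rwa [h2] at h1
  rw [transformPasses, if_neg hne]
  refine transformCount_le_of_le_abs hp hfl h2M hnM xs.sum _ m 0 _ xs (by omega) rfl
    (fun y hy => ⟨hxs y hy, by
      rw [show ((Nat.clog 2 (xs.length + 2) : ℤ) + Int.clog 2 (maxAbs xs) - (Nat.clog 2 (xs.length + 2) : ℤ))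
          = Int.clog 2 (maxAbs xs) by ring]
      exact (abs_le_maxAbs hy).trans hμK⟩)
    (isFloat_zero p emin) (onGrid_zero _) (by simp)
    (by rw [abs_zero]; exact mul_pos (pow_pos two_pos _) (two_zpow_pos _)) hsm

/-- **THEOREM 4.8.** Assume `AccSum` (Algorithm 4.5, with `Transform` = Algorithm 4.1) is applied to a
vector of floating-point numbers `pᵢ`, `1 ≤ i ≤ n`, with nonzero sum `s`; `M := ⌈log₂(n + 2)⌉`, `2²ᴹeps ≤ 1`.
If `cond(Σ pᵢ) ≤ (1 − 2⁻ᴹ)·2^(−2M−1)·[2⁻ᴹeps⁻¹]ᵐ` (4.26), then `Transform` stops after at most `m`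
executions of the "repeat–until"-loop. (Proof as printed: `½σ₀ < 2ᴹμ`, `|s| = C⁻¹Σ|pᵢ| ≥ μC⁻¹`, and
`(1 − 2⁻ᴹ)⁻¹ > 1 + 2⁻ᴹ` give `|s| > (2ᴹ + 1)ϕᵐσ₀`.) The flop count `(4m + 3)n + O(m)` is not typed.
[cite: RumpOgitaOishi2008, Theorem 4.8 eq. (4.26)] -/
theorem transformPasses_le_of_cond_le (hfl : IsRoundNearest p emin fl) {xs : List ℚ}
    (hxs : ∀ x ∈ xs, IsFloat p emin x) (hs : xs.sum ≠ 0) (h2M : 2 * Nat.clog 2 (xs.length + 2) ≤ p)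
    {m : ℕ}
    (hcond : condSum xs ≤ (1 - 1 / 2 ^ Nat.clog 2 (xs.length + 2)) *
        (1 / 2 ^ (2 * Nat.clog 2 (xs.length + 2) + 1)) * (2 ^ p / 2 ^ Nat.clog 2 (xs.length + 2)) ^ m) :
    transformPasses fl p emin xs ≤ m := by
  set M : ℕ := Nat.clog 2 (xs.length + 2) with hMdef
  have hM1 : 1 ≤ M := one_le_clog_length_add_two xs
  have hp : 1 ≤ p := by omega
  have h2 : (2 : ℚ) ≠ 0 := by norm_num
  have hne : maxAbs xs ≠ 0 := by
    intro h0
    apply hs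
    exact List.sum_eq_zero (fun x hx => maxAbs_eq_zero_iff.mp h0 x hx)
  set μ : ℚ := maxAbs xs with hμdef
  set K : ℤ := Int.clog 2 μ with hKdef
  have hμpos : 0 < μ := lt_of_le_of_ne (maxAbs_nonneg xs) (Ne.symm hne)
  -- (4.27): `½σ₀ < 2ᴹμ`, i.e. `2^(K-1) < μ`
  have hKμ : (2 : ℚ) ^ (K - 1) < μ := by
    have := Int.zpow_pred_clog_lt_self (R := ℚ) (b := 2) (by norm_num) hμpos; exact_mod_cast this
  -- `|s| ≥ Σ|pᵢ| / B ≥ μ / B` for the bound `B` of (4.26)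
  set B : ℚ := (1 - 1 / 2 ^ M) * (1 / 2 ^ (2 * M + 1)) * (2 ^ p / 2 ^ M) ^ m with hBdef
  have hspos : 0 < |xs.sum| := abs_pos.mpr hs
  have hM2 : (1 : ℚ) < 2 ^ M := one_lt_pow₀ (by norm_num) (by omega)
  have hBpos : 0 < B := by
    have : (0 : ℚ) < 1 - 1 / 2 ^ M := by
      rw [sub_pos, div_lt_one (by positivity)]; exact hM2
    positivity
  have hsumB : (xs.map abs).sum ≤ B * |xs.sum| := by
    have := hcond; rw [condSum, div_le_iff₀ hspos] at this; exact this
  have hμs : μ ≤ B * |xs.sum| := (maxAbs_le_sum_abs xs).trans hsumB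
  -- the key estimate: `B·(2ᴹ + 1)ϕᵐσ₀ = (1 − 2^(−2M))·2^(K−1) < 2^(K−1) < μ ≤ B|s|`
  have hφ : (2 ^ p / 2 ^ M : ℚ) * (2 ^ M * unitRoundoff p) = 1 := by
    rw [unitRoundoff]; field_simp
  have hprod : (2 ^ p / 2 ^ M : ℚ) ^ m * (2 ^ M * unitRoundoff p) ^ m = 1 := by
    rw [← mul_pow, hφ, one_pow]
  have hK1 : (2 : ℚ) ^ K = 2 * (2 : ℚ) ^ (K - 1) := by
    rw [show (2 : ℚ) ^ K = (2 : ℚ) ^ (K - 1 + 1) by rw [sub_add_cancel], zpow_add_one₀ h2, mul_comm]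
  have hσ₀ : (2 : ℚ) ^ ((M : ℤ) + K) = 2 ^ M * (2 * (2 : ℚ) ^ (K - 1)) := by
    rw [zpow_add₀ h2, zpow_natCast, hK1]
  have h2M1 : (2 : ℚ) ^ (2 * M + 1) = 2 ^ M * 2 ^ M * 2 := by rw [pow_succ, two_mul, pow_add]
  have hP := two_zpow_pos (K - 1)
  have hBL : B * ((2 ^ M + 1) * (2 ^ M * unitRoundoff p) ^ m * (2 : ℚ) ^ ((M : ℤ) + K)) =
      (1 - 1 / (2 ^ M * 2 ^ M)) * (2 : ℚ) ^ (K - 1) := by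
    calc B * ((2 ^ M + 1) * (2 ^ M * unitRoundoff p) ^ m * (2 : ℚ) ^ ((M : ℤ) + K))
        = (1 - 1 / 2 ^ M) * (1 / 2 ^ (2 * M + 1)) * (2 ^ M + 1) * (2 : ℚ) ^ ((M : ℤ) + K) *
            ((2 ^ p / 2 ^ M : ℚ) ^ m * (2 ^ M * unitRoundoff p) ^ m) := by rw [hBdef]; ring
      _ = (1 - 1 / 2 ^ M) * (1 / 2 ^ (2 * M + 1)) * (2 ^ M + 1) * (2 : ℚ) ^ ((M : ℤ) + K) := by
            rw [hprod, mul_one]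
      _ = (1 - 1 / (2 ^ M * 2 ^ M)) * (2 : ℚ) ^ (K - 1) := by
            rw [hσ₀, h2M1]; field_simp; ring
  have hkey : B * ((2 ^ M + 1) * (2 ^ M * unitRoundoff p) ^ m * (2 : ℚ) ^ ((M : ℤ) + K)) < B * |xs.sum| := by
    rw [hBL]
    have h1 : (1 - 1 / (2 ^ M * 2 ^ M)) * (2 : ℚ) ^ (K - 1) < (2 : ℚ) ^ (K - 1) := by
      have : 0 < 1 / (2 ^ M * 2 ^ M) * (2 : ℚ) ^ (K - 1) := by positivity
      nlinarith
    exact h1.trans (hKμ.trans_le hμs)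
  exact transformPasses_le_of_le_abs hp hfl hxs hne h2M (lt_of_mul_lt_mul_left hkey hBpos.le).le

end Literature.ComputerArithmetic.RumpOgitaOishi2008
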